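import Summits.BirchSwinnertonDyer.BirchSwinnertonDyer.Theorems.SignedLowerHalvesKobayashiMainConjectureSmallImageFineMuAnyReduction
import Summits.BirchSwinnertonDyer.BirchSwinnertonDyer.Theorems.PrintX8SmallImageMuReading
import Literature.NumberTheory.EllipticCurves.Sprung2012.SharpFlatColemanKatoZeta
import HarnessLib

/-!
# Route `PrintX8`, crux `SharpFlatMainConjectureSmallImageX8` (stmt-BirchSwinnertonDyer-20402): the ♯/♭
# EULER-SYSTEM `μ`-TRANSFER at NON-SURJECTIVE image — «`μ(L^•_3(E)) = 0 ⟹ μ(X^•(E/ℚ_∞)) = 0`»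
# CLASS-WIDE on X8 ∩ {ρ̄_{E,3} not onto}, hence the crux from K1 + ONE analytic rider per pair and colour
# (cell `bsd-print-x8`, D-0131 (2) print tier, seat p1 gen 2 «Sprung 2024 (a_p ≠ 0 ♯♭ main-conjecture
# consequences for BSD_p) BY NAME: acquire, type, discharge»; `--supports` 20402; theorems only)

PARTITION (cell bsd-print-x8, leaf `ClassX8` = K3 row A8 = W-ALL row 8; 217 census cells, 61 of them
with image `N_ns⁺(3)`): types-the-object-of the `μ`-part of crux 20402 on ALL small-image X8 pairs
(rank-free); closes NONE; 0 census cells move; BSD is not proved by any of this. beyond-print theorem: no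
(kernel form of the Kato–Kobayashi–Sprung deductions on pinned objects + one displayed analytic rider).

HONEST FRAMING. The ♯/♭ main [C] at `(3, a₃ = ±3)` on the 61 non-surjective pairs is OPEN and stays so:
its Eisenstein half K1 (stmt-19875, shared with route K3) has no engine in print (p1 g2's at-the-page
verdict: Sprung 2024 Thm. 1.1 ⇐ Conj. 3.33 ∧ CLW22 Thm. 8.2.1 at ξ = 𝟙 ∧ square-free `N`), and — given
K1 — the crux IS the `μ`-inequality `μ(X^•) ≤ μ(Λ/(ϖL^•))` (p3 g1, `PrintX8SmallImageMuSplit`: Sprung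
2012 Thm. 7.16 gives Kato's divisibility only up to `3ⁿ` because Kato's (12.5.2) fails for image
`N_ns⁺(3)`). THIS FILE supplies the `μ`-vanishing `μ(X^•(E/ℚ_∞)) = 0` from `E`'s OWN ♯/♭ `p`-adic
`L`-function, WITHOUT big image and WITHOUT a congruence partner — the fourth client (after good-ordinary
X9/X10b, `p ∥ N`, and `a_p = 0` X7: `SmallImageSignedMuTransfer.signedMu_eq_zero_of_hasUnitContent`) of the
reduction-free core `CoreAssembly.coreOdd_anyReduction_holds` — run with Sprung's ♯/♭ Coleman maps
(construction fact `Sprung2012.thm714seq_sharpFlatColemanKato_zeta`, this seat, the ♯/♭ twin of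
`Kobayashi2003.thm62_63_73_signedColemanKato_zeta`): unit coefficient of `L^•_p(E)` ⟹ (Def. 6.1 on ideals
at `(p)` + Kato Thm. 12.6 span clause) a GENUINE Euler-system class `∉ p𝐇¹` ⟹ (core)
`length_(p) X₀(E/ℚ_∞) = 0` ⟹ ((3) of Thm. 7.14 through `Col^•`) `length_(p) X^• = 0`.

## Contents (theorems only; every non-published input a DISPLAYED binder)

* §1 `sharpFlatMu_eq_zero_of_hasUnitContent` — odd good SUPERSINGULAR `p` (any `a_p`, `p ∣ a_p`),
  `ρ̄_{E,p}` NOT surjective, newform `f`, period ratio `ϖ` with `|ϖ|_p = 1` displayed, colour `•`, Sprung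
  pair `(L♯, L♭)` with `HasUnitContent (L^•)` ⟹ every `D : SharpFlatSelmerDualData …` has `μ(D.X) = 0`,
  modulo `hCK` alone; `X8.sharpFlatMu_eq_zero` — on X8 ∩ ¬surj(3), `|ϖ|₃ = 1`
  DISCHARGED by the period fact at `3` (`X8_norm_periodRatio_eq_one`).
* §2 `X8.sprungSharpFlatMainConjecture_of_lowerDivisibility_of_sharpFlatMuAn` — PER PAIR, ANY rank, image
  `N_ns⁺(3)`: K1's predicate for `•` + the analytic rider «`HasUnitContent (L^•_3(E))` for the Sprung pair
  of every newform of `W`» ⟹ Sprung's Main [C] 7.21 for `(E, 3, •)` (§1 ∘ p3 g1's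
  `X8.sprungSharpFlatMainConjecture_of_lowerDivisibility_of_muInvariant_eq_zero`), modulo `hCK`, Sprung
  2012 Thms. 7.14 / 7.16 and the period unit at `3` BY NAME.
* §3 CLASS FORM (route-independent; the rider is a displayed `Prop`-valued hypothesis SHAPE, spelled out
  in the signature, exact text also in HOME/P1-SharpFlatMuAnSmallImageX8-signature.lean.txt): the
  `μ`-BOUND shape of the planner's child of 20402, `muBound_smallImageX8_of_sharpFlatMuAn` («`μ(X^•) ≤
  μ(Λ/(L^•))` on the small-image X8 pairs of rank `≤ 1`» ⟸ rider + `hCK` + period unit at `3`, NO K1).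
  The BY-NAME closers of the route decl `Theses.PrintX8.SharpFlatMainConjectureSmallImageX8` (20402 ⟸
  19875 + rider) live in the sibling glue file `PrintX8SharpFlatMuTransferGlue.lean` (imports the route
  file; this file does not — theses-cone clean).

What is NOT here: the Eisenstein half K1 (no engine); any class-wide source of the rider (the Perrin-Riou
/ Pollack expectation `μ(L^{♯/♭}) = 0` — per pair a finite Mazur–Tate certificate, cf. K3's
`K1RankOne.mu_eq_zero_of_sharpFlatCharIdeal_eq_span`); anything booked.
References: [Sprung2012] Def. 6.1 (p. 1495), Props. 7.3/7.6 (pp. 1500–1501), Def. 7.9–7.13, Thm. 7.14 (3),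
Thm. 7.16, Prop. 7.19, Main [C] 7.21 (pp. 1503–1505); [Kato2004Asterisque] Thm. 12.6, Ex. 13.3, §13.8;
[Kobayashi2003] Thm. 5.1 iii), 5.2 iv), 7.3 i); [GreenbergVatsal2000] §3 Rem. 3.4; tree: the X7 twin
(`…SmallImageSignedMuTransfer.lean`, bsd-ssimc k3-c4x), part 1 `…SmallImageFineMuAnyReduction.lean`, the
core `Theorems/ErratumRoadFiveNonSurjCornerMuCore.lean` (bsd-stepL), p3 g1's `PrintX8SmallImageMuReading` /
`PrintX8SmallImageMuSplit` (p539576 / p540766).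
-/

set_option linter.dupNamespace false
set_option autoImplicit false

noncomputable section

open scoped Classical NumberField MatrixGroups ModularForm

open NumberField IsDedekindDomain WeierstrassCurve CongruenceSubgroup Field
  Literature.NumberTheory.EllipticCurves Literature.NumberTheory.EllipticCurves.ModularForms
  Literature.NumberTheory.EllipticCurves.Rank1Residual
  Literature.NumberTheory.EllipticCurves.Sprung2017 Literature.NumberTheory.EllipticCurves.Sprung2012
  Literature.NumberTheory.EllipticCurves.Kato2004 Literature.NumberTheory.EllipticCurves.GreenbergVatsal2000
  Literature.NumberTheory.EllipticCurves.ZpExtension Literature.NumberTheory.EllipticCurves.IwasawaAlgebra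
  Summit.BirchSwinnertonDyer.BirchSwinnertonDyer.Rank1Residual
  Summit.BirchSwinnertonDyer.BirchSwinnertonDyer.Theorems
  Summit.BirchSwinnertonDyer.BirchSwinnertonDyer.Theorems.SmallImageSignedMuTransfer
  Summit.BirchSwinnertonDyer.BirchSwinnertonDyer.Theorems.PrintX8MuReading
  Summit.BirchSwinnertonDyer.Rank1Residual.Supersingular

namespace Summit.BirchSwinnertonDyer.BirchSwinnertonDyer.Theorems.PrintX8SharpFlatMuTransfer

/-! ### §1 `μ(L^•_p(E)) = 0 ⟹ μ(X^•(E/ℚ_∞)) = 0` at non-surjective image, class-wide (any `a_p`) -/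

section Transfer

variable (W : WeierstrassCurve ℚ) [W.IsElliptic] [W.IsGloballyMinimal] (p : ℕ) [Fact p.Prime]

/-- **The ♯/♭ Kato `μ`-transfer WITHOUT big image (the twin of
`SmallImageSignedMuTransfer.signedMu_eq_zero_of_hasUnitContent` for EVERY supersingular `a_p`).** Let
`W/ℚ` be globally minimal, `p` an ODD prime of good reduction with `p ∣ a_p` (supersingular, so `E[p]`
irreducible) and `ρ̄_{E,p}` NOT surjective; let `f` be a newform of `W` with period ratio `ϖ`
(`ϖ·Ω_E = Ω⁺_f`) of `p`-adic norm `1` (displayed: `hϖ1`), `•` a colour and `(L♯, L♭)` the Sprung pair of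
`f` (`IsSprungPair f p a_p L♯ L♭`) whose `•`-member has a `p`-adic UNIT coefficient (`HasUnitContent`,
i.e. `μ(L^•_p(E)) = 0`). Granted the CONSTRUCTION fact `hCK` (Sprung 2012 Def. 6.1 + Props. 7.3/7.6 +
(3) of Thm. 7.14 at `η = 1` with Kato Thm. 12.6, `Sprung2012.thm714seq_sharpFlatColemanKato_zeta`): in
the cyclotomic / Honda setting `(κ, γ, v, g, cneg, c)` of Sprung 2012 Thm. 2.2 every Pontryagin-dual
datum `D` of `Sel^•(E/ℚ_∞)` has `μ = 0`. Chain: `G₁ := C(u)·L^•` (`u = ϖ`) is Sprung's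
Néron-normalised `L^•_p(E, X) ∈ Λ`, `G₁ ∉ (p)`; the image clause at `𝔭 = (p)` and the span clause give a
genuine Euler-system class `∉ p𝐇¹_Γ(T_pW)` (`exists_mem_set_not_mem_pSmul`); the reduction-free core
gives `length_(p) X₀(E/ℚ_∞) = 0` (`fineSelmerDual_lengthAt_augIdealP_eq_zero_of_eulerSystemClass`);
(3) through `Col^•` gives `length_(p) X^• ≤ length_(p) X₀` (`lengthAt_le_of_exact_coleman_of_image_localized`);
`μ = length_(p)`. CONDITIONAL on the displayed binders; NO partner, NO congruence, NO preprint; the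
image enters only as «not onto». [cite: Sprung2012, Def. 6.1 (p. 1495), Prop. 7.3 (p. 1500), Prop. 7.6 (p. 1501), Thm. 7.14 (3) (p. 1504), Prop. 7.19 (p. 1505)]
[cite: Kato2004Asterisque, Thm. 12.6 (p. 222), Ex. 13.3 (p. 225), §13.8 (pp. 228–229)]
[cite: Kobayashi2003, Thm. 5.1 iii), Thm. 5.2 iv), Remark 5.3 i) (pp. 9–10)] -/
theorem sharpFlatMu_eq_zero_of_hasUnitContent (hCK : thm714seq_sharpFlatColemanKato_zeta)
    (hp : p ≠ 2) (hgood : W.HasGoodReductionAtPrime p) (hap : (p : ℤ) ∣ W.frobeniusTrace p)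
    (hns : ¬ W.HasSurjectiveModNGaloisRep p)
    {N : ℕ} [NeZero N] (f : CuspForm (Gamma0 N) 2) (hf : IsNewformOf W f)
    (ϖ : ℚ) (hϖ : (ϖ : ℝ) * W.realPeriodRat = plusPeriod f) (hϖ1 : ‖(ϖ : ℚ_[p])‖ = 1)
    (κ : ZpExtension ℚ p) (γ : absoluteGaloisGroup ℚ) (hκ : κ.IsCyclotomic) (hγ : κ.IsTopGenerator γ)
    (hγ' : IsCyclotomicVariable p γ)
    (v : HeightOneSpectrum (𝓞 ℚ)) (hv : (p : 𝓞 ℚ) ∈ v.asIdeal)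
    (g : absoluteGaloisGroup (v.adicCompletion ℚ))
    (hg : κ.IsTopGenerator (resGalOfEmb (closureEmb (K := ℚ) (v.adicCompletion ℚ)) g))
    (cneg : localPoints W (v.adicCompletion ℚ)) (c : ℕ → localPoints W (v.adicCompletion ℚ))
    (hH : IsHondaSystem κ (closureEmb (K := ℚ) (v.adicCompletion ℚ)) W (W.frobeniusTrace p) g cneg c)
    (col : Chroma) {Lsharp Lflat : IwasawaAlgebra p}
    (hL : IsSprungPair f p (W.frobeniusTrace p) Lsharp Lflat)
    (hu : HasUnitContent (chromaticL col Lsharp Lflat))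
    (D : SharpFlatSelmerDualData W κ γ (closureEmb (K := ℚ) (v.adicCompletion ℚ))
      (W.frobeniusTrace p) g c col) :
    muInvariant p D.X = 0 := by
  haveI : ContinuousSMul ℤ_[p] (W.tateModule p) := TateModule.continuousSMul_padicInt
  haveI : Module.Free ℤ_[p] (W.tateModule p) := W.module_free_tateModule_holds p
  haveI : Module.Finite ℤ_[p] (W.tateModule p) := W.module_finite_tateModule_holds p
  -- supersingular ⟹ `E[p]` irreducible
  have hirr : W.HasIrreducibleModPGaloisRep p :=
    hasIrreducibleModPGaloisRep_of_dvd_frobeniusTrace W p hp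
      (W.not_dvd_minimalDiscriminantInt_of_hasGoodReductionAtPrime' p hgood) hap
  -- the pinned objects `𝐇¹_Γ(T_pW)`, `X₀(E/ℚ_∞)` and the ♯/♭ package
  obtain ⟨I⟩ := nonempty_iwasawaH1Data_holds W p κ γ hκ hγ
  obtain ⟨Y⟩ := W.nonempty_fineSelmerDualData κ hγ
  obtain ⟨K⟩ := hCK W p f ϖ κ γ hp hgood hap hf hϖ hκ hγ hγ' v hv g hg cneg c hH col I
  obtain ⟨j, k, hcj, hjk, -⟩ := K.exact D Y
  -- the period ratio is a `p`-adic unit: `ϖ = u`, and `G₁ := C(u)·L^•` is Sprung's `L^•_p(E, X) ∈ Λ`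
  set L : IwasawaAlgebra p := chromaticL col Lsharp Lflat with hLdef
  obtain ⟨-, hι⟩ := span_C_units_mul_eq (PadicInt.mkUnits hϖ1) L
  set G₁ : IwasawaAlgebra p := PowerSeries.C ((PadicInt.mkUnits hϖ1 : ℤ_[p]ˣ) : ℤ_[p]) * L with hG₁def
  have hG₁ : iwasawaToPowerSeries p G₁ =
      PowerSeries.C ((ϖ : ℚ) : ℚ_[p]) * iwasawaToPowerSeries p L := by rw [hι, PadicInt.mkUnits_eq]
  -- `L ∉ (p)` (unit content), hence `G₁ ∉ (p)`
  have hLp : L ∉ IwasawaAlgebra.augIdealP p := KatoMuSkeleton.not_mem_augIdealP_of_hasUnitContent hu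
  have hG₁p : G₁ ∉ IwasawaAlgebra.augIdealP p := by
    intro h
    apply hLp
    have h' := Ideal.mul_mem_left (IwasawaAlgebra.augIdealP p)
      (PowerSeries.C (((PadicInt.mkUnits hϖ1)⁻¹ : ℤ_[p]ˣ) : ℤ_[p])) h
    rwa [hG₁def, ← mul_assoc, ← map_mul, Units.inv_mul, map_one, one_mul] at h'
  -- the image clause at `𝔭 = (p)` and the span clause: a genuine Euler-system class outside `p𝐇¹`
  let 𝔭 : PrimeSpectrum (IwasawaAlgebra p) :=
    ⟨IwasawaAlgebra.augIdealP p, IwasawaAlgebra.isPrime_augIdealP_holds p⟩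
  obtain ⟨s, hs, hsG, -⟩ :=
    K.image_zeta_localized hirr Lsharp Lflat G₁ hL hG₁ 𝔭 (by exact IwasawaAlgebra.height_augIdealP_holds p)
  obtain ⟨z, hzES, hzp⟩ := exists_mem_set_not_mem_pSmul K.colMap K.Z K.zeta_le_span hs hG₁p hsG
  -- the reduction-free core: `length_(p) X₀(E/ℚ_∞) = 0`
  obtain ⟨_, hY0⟩ := fineSelmerDual_lengthAt_augIdealP_eq_zero_of_eulerSystemClass W p κ γ I hp hirr
    hns hκ hγ ⟨z, hzES, hzp⟩ Y 𝔭 rfl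
  -- (3) through `Col^•`: `length_(p) X^• ≤ length_(p) X₀ = 0`
  have hX0 : Module.lengthAt (IwasawaAlgebra p) D.X 𝔭 = 0 :=
    le_antisymm ((lengthAt_le_of_exact_coleman_of_image_localized K.colMap j k hcj hjk K.Z 𝔭 hs hG₁p
      hsG).trans hY0.le) bot_le
  rw [muInvariant_eq_toNat_lengthAt p D.X 𝔭 rfl, hX0]
  rfl

/-- **The same on X8 ∩ {ρ̄_{E,3} not onto}, with the period unit DISCHARGED by the period fact at `3`**
(`realPeriodRat_eq_unit_mul_plusPeriod_three` BY NAME, through `X8_norm_periodRatio_eq_one`; `E[3]`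
irreducible on X8): for every X8 pair with `¬ Surj W 3`, newform `f`, period ratio `ϖ`, colour `•` and
Sprung pair with `HasUnitContent (L^•)`, every dual datum of `Sel^•(E/ℚ_∞)` has `μ = 0`. CONDITIONAL on
`hCK`, `h3` and the rider; NO partner. [cite: Sprung2012, Def. 6.1 (p. 1495), Thm. 7.14 (3) (p. 1504)]
[cite: Kato2004Asterisque, Thm. 12.6 (p. 222), §13.8] [cite: GreenbergVatsal2000, §3 Remark 3.4] -/
theorem X8.sharpFlatMu_eq_zero (hCK : thm714seq_sharpFlatColemanKato_zeta)
    (h3 : realPeriodRat_eq_unit_mul_plusPeriod_three)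
    (hX : ClassX8 W p) (hns : ¬ Surj W p)
    {N : ℕ} [NeZero N] (f : CuspForm (Gamma0 N) 2) (hf : IsNewformOf W f)
    (ϖ : ℚ) (hϖ : (ϖ : ℝ) * W.realPeriodRat = plusPeriod f)
    (κ : ZpExtension ℚ p) (γ : absoluteGaloisGroup ℚ) (hκ : κ.IsCyclotomic) (hγ : κ.IsTopGenerator γ)
    (hγ' : IsCyclotomicVariable p γ)
    (v : HeightOneSpectrum (𝓞 ℚ)) (hv : (p : 𝓞 ℚ) ∈ v.asIdeal)
    (g : absoluteGaloisGroup (v.adicCompletion ℚ))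
    (hg : κ.IsTopGenerator (resGalOfEmb (closureEmb (K := ℚ) (v.adicCompletion ℚ)) g))
    (cneg : localPoints W (v.adicCompletion ℚ)) (c : ℕ → localPoints W (v.adicCompletion ℚ))
    (hH : IsHondaSystem κ (closureEmb (K := ℚ) (v.adicCompletion ℚ)) W (W.frobeniusTrace p) g cneg c)
    (col : Chroma) {Lsharp Lflat : IwasawaAlgebra p}
    (hL : IsSprungPair f p (W.frobeniusTrace p) Lsharp Lflat)
    (hu : HasUnitContent (chromaticL col Lsharp Lflat))
    (D : SharpFlatSelmerDualData W κ γ (closureEmb (K := ℚ) (v.adicCompletion ℚ))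
      (W.frobeniusTrace p) g c col) :
    muInvariant p D.X = 0 := by
  have hϖ1 : ‖(ϖ : ℚ_[p])‖ = 1 := X8_norm_periodRatio_eq_one h3 W p hX hf hϖ
  obtain ⟨hp3, ⟨hgood, hap⟩, -⟩ := hX
  subst hp3
  exact sharpFlatMu_eq_zero_of_hasUnitContent W 3 hCK (by decide) hgood hap hns f hf ϖ hϖ hϖ1
    κ γ hκ hγ hγ' v hv g hg cneg c hH col hL hu D

end Transfer

/-! ### §2 PER PAIR: K1's predicate + the analytic rider ⟹ Sprung's Main [C] 7.21, image `N_ns⁺(3)`, any rank -/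

section PerPair

variable (W : WeierstrassCurve ℚ) [W.IsElliptic] [W.IsGloballyMinimal] (p : ℕ) [Fact p.Prime]

/-- **X8, `ρ̄_{E,3}` NOT onto, colour `•`, ANY analytic rank: K1's predicate for `•` + the analytic
rider «the `•`-member of the Sprung pair of every newform of `W` has a `3`-adic unit coefficient whenever
it is non-zero» ⟹ Sprung's Main [C] 7.21 for `(E, 3, •)`** — §1 (`μ(X^•) = 0` from `E` itself) fed into
p3 g1's `μ = 0` door `X8.sprungSharpFlatMainConjecture_of_lowerDivisibility_of_muInvariant_eq_zero` (a
period ratio for the newform at hand comes from the period fact at `3`). Binders BY NAME: `hCK`, Sprung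
2012 Thm. 7.14 (`h714`), Thm. 7.16 RATIONAL clause (`h716`), the period unit at `3` (`h3`); displayed: K1
at the pair (`hK1`), the rider (`hμan`). NO partner, NO congruence, NO `BSD(E,3)` input, NO image
hypothesis beyond «not onto». [cite: Sprung2012, Thm. 7.14, Thm. 7.16 (p. 1504) and Main Conj. 7.21 (p. 1505)]
[cite: Kato2004Asterisque, Thm. 12.6 (p. 222) and §13.8] [cite: GreenbergVatsal2000, §3 Remark 3.4] -/
theorem X8.sprungSharpFlatMainConjecture_of_lowerDivisibility_of_sharpFlatMuAn
    (hCK : thm714seq_sharpFlatColemanKato_zeta)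
    (h714 : thm714_sharpFlatSelmerDual_finite_torsion)
    (h716 : thm716_sharpFlatCharIdeal_divisibility)
    (h3 : realPeriodRat_eq_unit_mul_plusPeriod_three)
    (hX : ClassX8 W p) (hns : ¬ Surj W p) (col : Chroma) (hK1 : SprungSharpFlatLowerDivisibility W p col)
    (hμan : ∀ (N : ℕ) (_ : NeZero N) (f : CuspForm (Gamma0 N) 2) (Lsharp Lflat : IwasawaAlgebra p),
      IsNewformOf W f → IsSprungPair f p (W.frobeniusTrace p) Lsharp Lflat →
      chromaticL col Lsharp Lflat ≠ 0 → HasUnitContent (chromaticL col Lsharp Lflat)) :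
    SprungSharpFlatMainConjecture W p col := by
  refine X8.sprungSharpFlatMainConjecture_of_lowerDivisibility_of_muInvariant_eq_zero h714 h716 h3 W p
    hX col hK1 fun κ γ hκ hγ hγ' v hv g hg cneg c hH N hN f Lsharp Lflat hf hSP hcol D ↦ ?_
  haveI := hN
  -- a period ratio for `f` from the period fact at `3`
  have hp3 : p = 3 := hX.1
  subst hp3
  obtain ⟨u, hu1, hΩ⟩ := h3 W hX.2.1.1 (ClassX8.irr W 3 hX) f hf
  have hu0 : (u : ℝ) ≠ 0 := by
    intro h
    have h0 : u = 0 := by exact_mod_cast h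
    rw [h0] at hu1
    simp at hu1
  have hϖ : ((u⁻¹ : ℚ) : ℝ) * W.realPeriodRat = plusPeriod f := by
    rw [hΩ, Rat.cast_inv, ← mul_assoc, inv_mul_cancel₀ hu0, one_mul]
  exact X8.sharpFlatMu_eq_zero W 3 hCK h3 hX hns f hf u⁻¹ hϖ κ γ hκ hγ hγ' v hv g hg
    cneg c hH col hSP (hμan N hN f Lsharp Lflat hf hSP hcol) D

end PerPair

/-! ### §3 The `μ`-bound shape of the planner's child, from the rider alone (route-independent) -/

section ClassForms

/-- **The `μ`-BOUND shape of the planner's child of 20402 («`μ(X^•) ≤ μ(Λ/(L^•))` on the small-image X8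
pairs of rank `≤ 1`», p3 g1's split `PrintX8MuSplit.sharpFlatMainConjectureSmallImageX8_iff_lowerDivisibility_and_muBound`)
⟸ the analytic rider + `hCK` + the period unit at `3` — NO K1:** under the rider §1 gives
`μ(X^•(E/ℚ_∞)) = 0 ≤ μ(Λ/(L^•))`. CONDITIONAL; closes nothing.
[cite: Sprung2012, Def. 6.1 (p. 1495), Thm. 7.14 (3) (p. 1504)] [cite: Kato2004Asterisque, Thm. 12.6 (p. 222), §13.8] -/
theorem muBound_smallImageX8_of_sharpFlatMuAn (hCK : thm714seq_sharpFlatColemanKato_zeta)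
    (h3 : realPeriodRat_eq_unit_mul_plusPeriod_three)
    (hμan : ∀ (W : WeierstrassCurve ℚ) [W.IsElliptic] [W.IsGloballyMinimal] (p : ℕ) [Fact p.Prime],
        ClassX8 W p → ¬ Surj W p → ∀ (col : Chroma)
        (N : ℕ) (_ : NeZero N) (f : CuspForm (Gamma0 N) 2) (Lsharp Lflat : IwasawaAlgebra p),
        IsNewformOf W f → IsSprungPair f p (W.frobeniusTrace p) Lsharp Lflat →
        chromaticL col Lsharp Lflat ≠ 0 → HasUnitContent (chromaticL col Lsharp Lflat))
    (W : WeierstrassCurve ℚ) [W.IsElliptic] [W.IsGloballyMinimal] (p : ℕ) [Fact p.Prime]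
    (hX : ClassX8 W p) (hns : ¬ Surj W p) (_hr : W.analyticRank ≤ 1) (col : Chroma)
    (κ : ZpExtension ℚ p) (γ : absoluteGaloisGroup ℚ) (hκ : κ.IsCyclotomic) (hγ : κ.IsTopGenerator γ)
    (hγ' : IsCyclotomicVariable p γ)
    (v : HeightOneSpectrum (𝓞 ℚ)) (hv : (p : 𝓞 ℚ) ∈ v.asIdeal)
    (g : absoluteGaloisGroup (v.adicCompletion ℚ))
    (hg : κ.IsTopGenerator (resGalOfEmb (closureEmb (K := ℚ) (v.adicCompletion ℚ)) g))
    (cneg : localPoints W (v.adicCompletion ℚ)) (c : ℕ → localPoints W (v.adicCompletion ℚ))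
    (hH : IsHondaSystem κ (closureEmb (K := ℚ) (v.adicCompletion ℚ)) W (W.frobeniusTrace p) g cneg c)
    (N : ℕ) (hN : NeZero N) (f : CuspForm (Gamma0 N) 2) (Lsharp Lflat : IwasawaAlgebra p)
    (hf : IsNewformOf W f) (hSP : IsSprungPair f p (W.frobeniusTrace p) Lsharp Lflat)
    (hcol : chromaticL col Lsharp Lflat ≠ 0)
    (D : SharpFlatSelmerDualData W κ γ (closureEmb (K := ℚ) (v.adicCompletion ℚ))
      (W.frobeniusTrace p) g c col) :
    muInvariant p D.X ≤ muInvariant p (IwasawaAlgebra p ⧸ Ideal.span {chromaticL col Lsharp Lflat}) := by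
  haveI := hN
  have hp3 : p = 3 := hX.1
  subst hp3
  obtain ⟨u, hu1, hΩ⟩ := h3 W hX.2.1.1 (ClassX8.irr W 3 hX) f hf
  have hu0 : (u : ℝ) ≠ 0 := by
    intro h
    have h0 : u = 0 := by exact_mod_cast h
    rw [h0] at hu1
    simp at hu1
  have hϖ : ((u⁻¹ : ℚ) : ℝ) * W.realPeriodRat = plusPeriod f := by
    rw [hΩ, Rat.cast_inv, ← mul_assoc, inv_mul_cancel₀ hu0, one_mul]
  rw [X8.sharpFlatMu_eq_zero W 3 hCK h3 hX hns f hf u⁻¹ hϖ κ γ hκ hγ hγ' v hv g hg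
    cneg c hH col hSP (hμan W 3 hX hns col N hN f Lsharp Lflat hf hSP hcol) D]
  exact Nat.zero_le _

end ClassForms

end Summit.BirchSwinnertonDyer.BirchSwinnertonDyer.Theorems.PrintX8SharpFlatMuTransfer

end
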